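import Literature.AnabelianGeometry.EtaleTheta.Discharge.Sec3TemperedFrobenioidRigidOverBaseOfDataRigid
import Literature.AlgebraicGeometry.Frobenioids.ModelFrobenioidUnitTwistVacuityWitness
import HarnessLib

/-!
# [IUTchI] Cor 5.3 (iv) telescope at the [EtTh] carrier — BINDER VACUITY NOTE (OURS, negative): the displayed pair
# {`SelfEquivInducesDataAut`, `DivisorDataRigid`} of lane 1 is JOINTLY UNSATISFIABLE at every tempered Frobenioid carrying a
# non-trivial divisor-free base-compatible unit (e.g. `−1`), by abc-iut-L1-t7's unit-twist self-equivalence (L5-R22 witness)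

S. Mochizuki, *Inter-universal Teichmüller theory I*, kurims manuscript (May 2020), §5 Cor 5.3 (iv), proof p. 145 l. 1–2 («it suffices to
verify that `α` induces … the identity on the rational function and divisor monoids of `ℱ̲_v̲`») ([IUTchI] Cor 5.3 (iv) p.145)
[claim: Mochizuki2012, status: disputed] (D-0012 claim key; nothing of the series is asserted; no side taken on [IUTchIII] Cor. 3.12);
S. Mochizuki, *The geometry of Frobenioids I*, Thm 5.2 (i)/(ii) pp. 100–101 (a morphism of the model Frobenioid IS `(deg_Fr, Base, Div, u)`;
`B ≅ O^×((−)^birat)` is the monoid of BIRATIONAL units) [cite: MochizukiFrdI2008, Thm. 5.2(i) p.100]; [EtTh] Def 3.6 p. 77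
[cite: MochizukiEtTh2009, Def 3.6 p.77].

PROOF-ONLY (cell abc-iut, seat abc-iut-L5-t1 gen 13; consumer-side census note for MY knit ★ p528750 `Cor53ivTelescopeKnit`, whose header
displays FACT-SHAPE {hind, hrig}).  abc-iut-L2-t12's lane-1 file ★ p527197 renders print's S3–S5 as two displayed Props on the Def 3.6 data:
`TemperedFrobenioid.SelfEquivInducesDataAut C` (hind: every self-equivalence `Ψ` over `id_D` arises, up to `η`, from a data automorphism
`τ = (a, b)` with `Div(Ψ φ) = η^* a(Div φ)` AND `u_{Ψ φ} = η^* b(u_φ)` for EVERY arrow `φ`) and `TemperedFrobenioid.DivisorDataRigid C` (hrig: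
every data automorphism is trivial).  The unit clause of hind is the ENTRY-WISE reading of «identity on the rational-function monoid» —
the very reading abc-iut-L1-t7's ★ `ModelFrobenioid.exists_unitTwist_selfEquivalence` (`ModelFrobenioidUnitTwistVacuityWitness`, L5-R22)
showed UNSATISFIABLE at any model Frobenioid carrying a family of units `w_A ∈ B(A)` that is divisor-free, base-compatible and non-trivial:
the unit twist `Ψ_w` (`u_φ ↦ u_φ · w^{deg_Fr φ − 1}`, isomorphic to `𝟭` — so harmless for the injectivity CONCLUSION) lies over `id_D`, yet
`u_{Ψ_w Fr₂} = w_A ≠ 1 = η'^*(u_{Fr₂})` at the degree-2 Frobenius endomorphism `Fr₂ = (2, id, 0, 1)`.  Under hrig the data automorphism `b`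
produced by hind is the identity, so hind's unit clause becomes exactly that entry-wise law.  HENCE:

* **`TemperedFrobenioid.not_selfEquivInducesDataAut_and_divisorDataRigid`** — at every [EtTh] Def 3.6 tempered Frobenioid `C` whose
  rational-function monoid carries such a `w` (e.g. `w = −1` whenever `B(A)` contains the units of a field of characteristic `≠ 2`, as
  `B = B₀^Λ ×_{(Φ^{ℝ-log})^gp} Φ^gp` does in print's situation — the roots of unity), `¬ (C.SelfEquivInducesDataAut ∧ C.DivisorDataRigid)`.

CONSEQUENCE FOR THE (iv) CENSUS (honest, OURS): the displayed injectivity pair {hind, hrig} is jointly satisfiable ONLY at carriers with NO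
non-trivial divisor-free base-compatible unit (in addition to the R1444 flag on hrig alone); print is not hit — print's «identity on the
rational function monoid» concerns BIRATIONAL units (ratios `u_f/u_g` of parallel linear arrows), which is exactly the `hratio` clause of
abc-iut-L5-t4's print-strength ★ p516053 `hrat` that lane 1 PRODUCES; the natural REPAIR (for the L2/L5 leads to rule, not done here) is to
weaken hind's unit clause to that ratio form (`u_{Ψ f} · η^* b(u_g) = u_{Ψ g} · η^* b(u_f)` for parallel linear `f, g`), from which
`hrat_of_divisorDataRigid` goes through verbatim.  Nothing of [IUTchI]/[EtTh] is asserted; refutable-as-typed ≠ refuted in print; no token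
is moved by this file; nothing here asserts abc proved or refuted.  No definitions, no instances.
-/

namespace Literature.AnabelianGeometry.EtaleTheta

open CategoryTheory Opposite Literature.AlgebraicGeometry.Frobenioids Literature.IUT.HodgeTheaters

namespace TemperedFrobenioid

universe u₀ v₀ u v w

variable {D₀ : Type u₀} [Category.{v₀} D₀] {V : FrdIMonoidStub.{w}} {T : RealifiedDivisorMonoids (D₀ := D₀) V}
  {D : Type u} [Category.{v} D] {VD : FrdICatStub.{u, v, w} D} (C : TemperedFrobenioid T D VD)

/-- **The lane-1 pair {`SelfEquivInducesDataAut`, `DivisorDataRigid`} is jointly unsatisfiable at every [EtTh] Def 3.6 tempered Frobenioid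
carrying a non-trivial divisor-free base-compatible unit** (OURS, negative; a dot-notation extension of abc-iut-L2-t3's `TemperedFrobenioid`
declared from the L5 consumer side).  Given units `w_A ∈ B(A)` (`A ∈ Ob(D)`) with `Div_B(w_A) = 0`, `B(f)(w_{A'}) = w_A` and some `w_A ≠ 1`:
if every self-equivalence over `id_D` arose up to `η` from a data automorphism `(a, b)` ENTRY-WISE on units (hind) and every data
automorphism were trivial (hrig), then abc-iut-L1-t7's unit twist `Ψ_w` (★ `ModelFrobenioid.exists_unitTwist_selfEquivalence`) would satisfy
`u_{Ψ_w φ} = η'^* u_φ` for all `φ`, which it does not (degree-2 Frobenius endomorphism of `(A, 0)`).  Print's hypothesis is about BIRATIONAL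
units and is not hit. ([IUTchI] Cor 5.3 (iv) p.145) [cite: MochizukiFrdI2008, Thm. 5.2(i) p.100] [claim: Mochizuki2012, status: disputed] -/
theorem not_selfEquivInducesDataAut_and_divisorDataRigid
    (wu : ∀ A : D, C.ratFnFunctor.obj (op A)) (hwu : ∀ A : D, IsUnit (wu A))
    (hw0 : ∀ A : D, Literature.AlgebraicGeometry.Frobenioids.divB C.divisorMonoid C.ratFnFunctor C.divBNatTrans (op A) (wu A) = 1)
    (hwn : ∀ ⦃A A' : D⦄ (f : A ⟶ A'), pull C.ratFnFunctor f (wu A') = wu A) (hw1 : ∃ A : D, wu A ≠ 1) :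
    ¬ (C.SelfEquivInducesDataAut ∧ C.DivisorDataRigid) := by
  rintro ⟨hind, hrig⟩
  obtain ⟨Ψ, η, -, -, -, hnot⟩ :=
    ModelFrobenioid.exists_unitTwist_selfEquivalence (DivB := C.divBNatTrans) wu hwu hw0 hwn hw1
  obtain ⟨η', τ, -, hunit⟩ := hind Ψ ⟨η⟩
  refine hnot η' fun X Y φ => ?_
  have h := hunit φ
  rw [(hrig τ).2] at h
  exact h

/-- Equivalently: at such a carrier, `DivisorDataRigid C` REFUTES `SelfEquivInducesDataAut C` (so the injectivity half of the (iv) telescope,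
`rigidOverBase_of_divisorDataRigid (hind) (hrig)`, has jointly unsatisfiable displayed binders there). ([IUTchI] Cor 5.3 (iv) p.145)
[cite: MochizukiFrdI2008, Thm. 5.2(i) p.100] [claim: Mochizuki2012, status: disputed] -/
theorem not_selfEquivInducesDataAut_of_divisorDataRigid
    (wu : ∀ A : D, C.ratFnFunctor.obj (op A)) (hwu : ∀ A : D, IsUnit (wu A))
    (hw0 : ∀ A : D, Literature.AlgebraicGeometry.Frobenioids.divB C.divisorMonoid C.ratFnFunctor C.divBNatTrans (op A) (wu A) = 1)
    (hwn : ∀ ⦃A A' : D⦄ (f : A ⟶ A'), pull C.ratFnFunctor f (wu A') = wu A) (hw1 : ∃ A : D, wu A ≠ 1)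
    (hrig : C.DivisorDataRigid) : ¬ C.SelfEquivInducesDataAut :=
  fun hind => C.not_selfEquivInducesDataAut_and_divisorDataRigid wu hwu hw0 hwn hw1 ⟨hind, hrig⟩

end TemperedFrobenioid

end Literature.AnabelianGeometry.EtaleTheta
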